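import Literature.AnabelianGeometry.SemiGraphs.ProfiniteSemiGraphIsoInverse
import Literature.AnabelianGeometry.SemiGraphs.ProfiniteHomToAnabPullback
import Literature.AnabelianGeometry.SemiGraphs.TemperedVerticialInjective
import Literature.AnabelianGeometry.SemiGraphs.BTempResEquiv
import HarnessLib

/-!
# Pull-back along an isomorphism of profinite presentations is an equivalence
# `B^cov(Y) ≌ B^cov(X)`, `B^temp(Y) ≌ B^temp(X)` (route T, TRANSPORT V)

Mochizuki, *Semi-graphs of anabelioids*, Publ. RIMS **42** (2006), §3 Prop. 3.6 (iv) p. 39 ("Any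
morphism of semi-graphs of anabelioids `G' → G` induces a morphism of temperoids `B^temp(G') → B^temp(G)`
[by pulling back tempered coverings of `G` to tempered coverings of `G'`]"), with Rmk. 2.4.2 p. 26
(2-cells) and Def. 2.2 (ii) p. 24 (locally trivial morphisms) [cite: MochizukiSemiAnbd2006, Prop 3.6(iv) p.39].

For `F : X → Y` with `IsIso F.base` and bijective constituents (`Hom.IsLocallyTrivial`), and ANY family
of 2-cells `θ : F.ConjugatorFamily` (abc-iut-L3-d4, `TemperedFunctorialityWith.lean`), the pull-back
`F^*_θ = F.covPullbackWith θ : B^cov(Y) ⥤ B^cov(X)` is an EQUIVALENCE of categories, with inverse the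
pull-back `(F⁻¹)^*_{θ⁻¹}` along the inverse morphism glued with the INVERSE 2-cells
(`Hom.inverse`, `Hom.inverseConjugators`, `ProfiniteSemiGraphIsoInverse.lean`) — the unit and counit
are the transports of points along `F (F⁻¹ w) = w`, `F⁻¹ (F v) = v` (the composite 2-cells being
trivial, the transports ARE compatible with the gluings; with freshly CHOSEN 2-cells for `F⁻¹` they would
differ from the identity by a profinite Dehn twist, cell finding RQ12):

* `Hom.covPullbackEquiv hlt θ : CovObj Y ≌ CovObj X`, `Hom.btempPullbackEquiv hlt θ : BTempCat Y ≌ BTempCat X`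
  (functor DEFINITIONALLY `F.covPullbackWith θ` / `F.btempPullbackWith θ`);
* `isEquivalence_covPullback` / `isEquivalence_btempPullback` — the part-1 functors `F.covPullback`,
  `F.btempPullback` (chosen 2-cells) are equivalences;
Sequel (`ProfiniteSemiGraphIsoTransportCharts`): Galois-countability and the §3 hypotheses descend
object-wise, the charts of `π₁^temp` transport with the same group, and the bodies of Thm 3.7 AT a graph
transport.

abc-iut cell, L3 route T · TRANSPORT (seat abc-iut-L3-d6); nothing here bears on [IUTchIII] Cor. 3.12.
-/

noncomputable section

open CategoryTheory Topology

namespace Literature.AnabelianGeometry.SemiGraphs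

namespace ProfiniteSemiGraph

open Literature.AlgebraicGeometry.Frobenioids.QuasiTemperoid.BTempConnected (hom_ext_apply hom_ρ ρ_mul_apply
  ρ_one_apply)

universe u

variable {X Y : ProfiniteSemiGraph.{u}}

/-! ### The gluings of a pull-back, with the re-indexing written as transport of points -/

/-- Underlying function of the gluing natural isomorphism `glueNatIsoAt`, the re-indexing written as
`castPtE`. [cite: MochizukiSemiAnbd2006, §3 p.36] -/
theorem glueNatIsoAt_hom_app_apply_castPtE {P : ProfiniteSemiGraph.{u}} (b : P.graph.Branch)
    (v : P.graph.Vertex) (h : P.graph.abuts b = some v) {f : P.graph.Edge} (q : P.graph.edgeOf b = f)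
    (S : CovObj P) (x : (S.SE f).obj.V) :
    ((P.glueNatIsoAt b v h f q).hom.app S).hom.hom x = (S.glue b v h).hom.hom.hom (S.castPtE q.symm x) := by
  subst q
  rfl

/-- **Underlying function of the gluing of `F^*_θ S` along `b'`**: the gluing of `S` along `F b'` at the
transported point, followed by the action of the 2-cell `θ_{b'}` (abc-iut-L3-d4's
`covPullbackWith_glue_apply` with the re-indexing written as `castPtE`).
[cite: MochizukiSemiAnbd2006, Prop 3.6(iv) p.39] -/
theorem Hom.covPullbackWith_glue_apply_castPtE (F : Hom X Y) (θ : F.ConjugatorFamily) (S : CovObj Y)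
    (b' : X.graph.Branch) (v' : X.graph.Vertex) (h' : X.graph.abuts b' = some v')
    (x : (((F.covPullbackWith θ).obj S).SE (X.graph.edgeOf b')).obj.V) :
    (((F.covPullbackWith θ).obj S).glue b' v' h').hom.hom.hom x =
      (S.SV (F.base.vertexMap v')).obj.ρ (θ.θ b' v' h')
        ((S.glue (F.base.branchMap b') (F.base.vertexMap v') (F.base.abuts_branchMap b' v' h')).hom.hom.hom
          (S.castPtE (F.base.edgeOf_branchMap b').symm x)) := by
  change (S.SV (F.base.vertexMap v')).obj.ρ (θ.θ b' v' h')
      (((Y.glueNatIsoAt (F.base.branchMap b') (F.base.vertexMap v') (F.base.abuts_branchMap b' v' h')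
        _ (F.base.edgeOf_branchMap b')).hom.app S).hom.hom x) = _
  rw [glueNatIsoAt_hom_app_apply_castPtE]

namespace Hom

variable (F : Hom X Y) (hlt : F.IsLocallyTrivial) [IsIso (C := SemiGraph.{u}) F.base] (θ : F.ConjugatorFamily)

/-! ### The unit `S ≅ (F⁻¹)^*_{θ⁻¹} (F^*_θ S)` on `B^cov(Y)`: transport of points along `w = F (F⁻¹ w)` -/

/-- Vertex component of the unit: the transport `S_w → S_{F(F⁻¹ w)}` is `Π_{Y,w}`-equivariant for the
action through `F_{F⁻¹ w} ∘ (F⁻¹)_w` (which IS the transport of groups). [cite: MochizukiSemiAnbd2006, Prop 3.6(iv) p.39] -/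
def unitIsoV (S : CovObj Y) (w : Y.graph.Vertex) :
    S.SV w ≅ (((F.inverse hlt).covPullbackWith (F.inverseConjugators hlt θ)).obj
      ((F.covPullbackWith θ).obj S)).SV w :=
  BTemp.isoOfEquiv
    (Equiv.cast (congrArg (fun v => ((S.SV v).obj.V : Type u))
      (SemiGraph.vertexMap_inv_vertexMap F.base w).symm))
    (fun g x => by
      change S.castPtV (SemiGraph.vertexMap_inv_vertexMap F.base w).symm ((S.SV w).obj.ρ g x) =
        (S.SV _).obj.ρ (F.hV _ (F.inverseHV hlt w g))
          (S.castPtV (SemiGraph.vertexMap_inv_vertexMap F.base w).symm x)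
      rw [CovObj.castPtV_ρ, hV_inverseHV])

/-- Edge component of the unit: the transport `S_e → S_{F(F⁻¹ e)}`. [cite: MochizukiSemiAnbd2006, Prop 3.6(iv) p.39] -/
def unitIsoE (S : CovObj Y) (e : Y.graph.Edge) :
    S.SE e ≅ (((F.inverse hlt).covPullbackWith (F.inverseConjugators hlt θ)).obj
      ((F.covPullbackWith θ).obj S)).SE e :=
  BTemp.isoOfEquiv
    (Equiv.cast (congrArg (fun e' => ((S.SE e').obj.V : Type u))
      (SemiGraph.edgeMap_inv_edgeMap F.base e).symm))
    (fun g x => by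
      change S.castPtE (SemiGraph.edgeMap_inv_edgeMap F.base e).symm ((S.SE e).obj.ρ g x) =
        (S.SE _).obj.ρ (F.hE _ (F.inverseHE hlt e g))
          (S.castPtE (SemiGraph.edgeMap_inv_edgeMap F.base e).symm x)
      rw [CovObj.castPtE_ρ, hE_inverseHE])

/-- Underlying map of the vertex component of the unit. [cite: MochizukiSemiAnbd2006, Prop 3.6(iv) p.39] -/
@[simp] theorem unitIsoV_hom_apply (S : CovObj Y) (w : Y.graph.Vertex) (x : (S.SV w).obj.V) :
    (F.unitIsoV hlt θ S w).hom.hom.hom x = S.castPtV (SemiGraph.vertexMap_inv_vertexMap F.base w).symm x :=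
  rfl

/-- Underlying map of the edge component of the unit. [cite: MochizukiSemiAnbd2006, Prop 3.6(iv) p.39] -/
@[simp] theorem unitIsoE_hom_apply (S : CovObj Y) (e : Y.graph.Edge) (x : (S.SE e).obj.V) :
    (F.unitIsoE hlt θ S e).hom.hom.hom x = S.castPtE (SemiGraph.edgeMap_inv_edgeMap F.base e).symm x :=
  rfl

/-- **The gluing of `(F⁻¹)^*_{θ⁻¹} (F^*_θ S)` along a branch `b` of `Y`** is the gluing of `S` along
`F (F⁻¹ b)`, re-indexed: the two 2-cells cancel (`hV_inverseθ_mul`). [cite: MochizukiSemiAnbd2006, Prop 3.6(iv) p.39] -/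
theorem inverse_covPullbackWith_covPullbackWith_glue_apply (S : CovObj Y) (b : Y.graph.Branch)
    (w : Y.graph.Vertex) (h : Y.graph.abuts b = some w)
    (x : ((((F.inverse hlt).covPullbackWith (F.inverseConjugators hlt θ)).obj
      ((F.covPullbackWith θ).obj S)).SE (Y.graph.edgeOf b)).obj.V) :
    ((((F.inverse hlt).covPullbackWith (F.inverseConjugators hlt θ)).obj
        ((F.covPullbackWith θ).obj S)).glue b w h).hom.hom.hom x =
      (S.glue (F.base.branchMap ((inv (C := SemiGraph.{u}) F.base).branchMap b))
          (F.base.vertexMap ((inv (C := SemiGraph.{u}) F.base).vertexMap w))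
          (F.base.abuts_branchMap _ _ ((inv (C := SemiGraph.{u}) F.base).abuts_branchMap b w h))).hom.hom.hom
        (S.castPtE ((congrArg F.base.edgeMap ((inv (C := SemiGraph.{u}) F.base).edgeOf_branchMap b).symm).trans
          (F.base.edgeOf_branchMap _).symm) x) := by
  rw [covPullbackWith_glue_apply_castPtE, CovObj.castPtE_covPullbackWith, inverseConjugators_θ]
  change (S.SV _).obj.ρ (F.hV _ (F.inverseθ hlt θ b w h))
      ((((F.covPullbackWith θ).obj S).glue _ _ _).hom.hom.hom _) = _
  rw [covPullbackWith_glue_apply_castPtE, ← ρ_mul_apply, hV_inverseθ_mul, ρ_one_apply,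
    CovObj.castPtE_castPtE]

/-- The components of the unit are compatible with the gluings. [cite: MochizukiSemiAnbd2006, Prop 3.6(iv) p.39] -/
theorem unitIso_comm (S : CovObj Y) (b : Y.graph.Branch) (w : Y.graph.Vertex)
    (h : Y.graph.abuts b = some w) :
    (F.unitIsoE hlt θ S (Y.graph.edgeOf b)).hom ≫
        ((((F.inverse hlt).covPullbackWith (F.inverseConjugators hlt θ)).obj
          ((F.covPullbackWith θ).obj S)).glue b w h).hom =
      (S.glue b w h).hom ≫ (BTemp.res (Y.brHom b w h)).map (F.unitIsoV hlt θ S w).hom := by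
  refine hom_ext_apply fun x => ?_
  change ((((F.inverse hlt).covPullbackWith (F.inverseConjugators hlt θ)).obj
      ((F.covPullbackWith θ).obj S)).glue b w h).hom.hom.hom ((F.unitIsoE hlt θ S _).hom.hom.hom x) =
    (F.unitIsoV hlt θ S w).hom.hom.hom ((S.glue b w h).hom.hom.hom x)
  rw [unitIsoE_hom_apply, unitIsoV_hom_apply, inverse_covPullbackWith_covPullbackWith_glue_apply,
    CovObj.castPtE_castPtE,
    S.castPtV_glue (SemiGraph.branchMap_inv_branchMap F.base b).symm
      (SemiGraph.vertexMap_inv_vertexMap F.base w).symm h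
      (F.base.abuts_branchMap _ _ ((inv (C := SemiGraph.{u}) F.base).abuts_branchMap b w h))]

/-- **The unit** `𝟭 ≅ F^*_θ ⋙ (F⁻¹)^*_{θ⁻¹}` on `B^cov(Y)`. [cite: MochizukiSemiAnbd2006, Prop 3.6(iv) p.39] -/
def covPullbackUnitIso :
    𝟭 (CovObj Y) ≅ F.covPullbackWith θ ⋙ (F.inverse hlt).covPullbackWith (F.inverseConjugators hlt θ) :=
  NatIso.ofComponents
    (fun S => CovObj.isoOfComponents (F.unitIsoV hlt θ S) (F.unitIsoE hlt θ S) (F.unitIso_comm hlt θ S))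
    (fun {S T} f => by
      refine CovHom.ext (funext fun w => hom_ext_apply fun x => ?_) (funext fun e => hom_ext_apply fun x => ?_)
      · change (F.unitIsoV hlt θ T w).hom.hom.hom ((f.fV w).hom.hom x) =
          (f.fV (F.base.vertexMap ((inv (C := SemiGraph.{u}) F.base).vertexMap w))).hom.hom
            ((F.unitIsoV hlt θ S w).hom.hom.hom x)
        rw [unitIsoV_hom_apply, unitIsoV_hom_apply, CovObj.castPtV_fV]
      · change (F.unitIsoE hlt θ T e).hom.hom.hom ((f.fE e).hom.hom x) =
          (f.fE (F.base.edgeMap ((inv (C := SemiGraph.{u}) F.base).edgeMap e))).hom.hom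
            ((F.unitIsoE hlt θ S e).hom.hom.hom x)
        rw [unitIsoE_hom_apply, unitIsoE_hom_apply, CovObj.castPtE_fE])

/-! ### The counit `F^*_θ ((F⁻¹)^*_{θ⁻¹} S') ≅ S'` on `B^cov(X)`: transport of points along `F⁻¹ (F v') = v'` -/

/-- Vertex component of the counit. [cite: MochizukiSemiAnbd2006, Prop 3.6(iv) p.39] -/
def counitIsoV (S' : CovObj X) (v' : X.graph.Vertex) :
    ((F.covPullbackWith θ).obj (((F.inverse hlt).covPullbackWith (F.inverseConjugators hlt θ)).obj S')).SV v' ≅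
      S'.SV v' :=
  BTemp.isoOfEquiv
    (Equiv.cast (congrArg (fun v => ((S'.SV v).obj.V : Type u))
      (SemiGraph.inv_vertexMap_vertexMap F.base v')))
    (fun g x => by
      change S'.castPtV (SemiGraph.inv_vertexMap_vertexMap F.base v')
          ((S'.SV _).obj.ρ (F.inverseHV hlt _ (F.hV v' g)) x) =
        (S'.SV v').obj.ρ g (S'.castPtV (SemiGraph.inv_vertexMap_vertexMap F.base v') x)
      rw [CovObj.castPtV_ρ, inverseHV_hV, castGv_castGv]
      rfl)

/-- Edge component of the counit. [cite: MochizukiSemiAnbd2006, Prop 3.6(iv) p.39] -/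
def counitIsoE (S' : CovObj X) (e' : X.graph.Edge) :
    ((F.covPullbackWith θ).obj (((F.inverse hlt).covPullbackWith (F.inverseConjugators hlt θ)).obj S')).SE e' ≅
      S'.SE e' :=
  BTemp.isoOfEquiv
    (Equiv.cast (congrArg (fun e => ((S'.SE e).obj.V : Type u))
      (SemiGraph.inv_edgeMap_edgeMap F.base e')))
    (fun g x => by
      change S'.castPtE (SemiGraph.inv_edgeMap_edgeMap F.base e')
          ((S'.SE _).obj.ρ (F.inverseHE hlt _ (F.hE e' g)) x) =
        (S'.SE e').obj.ρ g (S'.castPtE (SemiGraph.inv_edgeMap_edgeMap F.base e') x)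
      rw [CovObj.castPtE_ρ, inverseHE_hE, castGe_castGe]
      rfl)

/-- Underlying map of the vertex component of the counit. [cite: MochizukiSemiAnbd2006, Prop 3.6(iv) p.39] -/
@[simp] theorem counitIsoV_hom_apply (S' : CovObj X) (v' : X.graph.Vertex)
    (x : (S'.SV ((inv (C := SemiGraph.{u}) F.base).vertexMap (F.base.vertexMap v'))).obj.V) :
    (F.counitIsoV hlt θ S' v').hom.hom.hom x = S'.castPtV (SemiGraph.inv_vertexMap_vertexMap F.base v') x :=
  rfl

/-- Underlying map of the edge component of the counit. [cite: MochizukiSemiAnbd2006, Prop 3.6(iv) p.39] -/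
@[simp] theorem counitIsoE_hom_apply (S' : CovObj X) (e' : X.graph.Edge)
    (x : (S'.SE ((inv (C := SemiGraph.{u}) F.base).edgeMap (F.base.edgeMap e'))).obj.V) :
    (F.counitIsoE hlt θ S' e').hom.hom.hom x = S'.castPtE (SemiGraph.inv_edgeMap_edgeMap F.base e') x :=
  rfl

/-- **The gluing of `F^*_θ ((F⁻¹)^*_{θ⁻¹} S')` along a branch `b'` of `X`** is the gluing of `S'` along
`F⁻¹ (F b')`, re-indexed: the two 2-cells cancel (`inverseHV_θ_mul_inverseθ`).
[cite: MochizukiSemiAnbd2006, Prop 3.6(iv) p.39] -/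
theorem covPullbackWith_inverse_covPullbackWith_glue_apply (S' : CovObj X) (b' : X.graph.Branch)
    (v' : X.graph.Vertex) (h' : X.graph.abuts b' = some v')
    (x : (((F.covPullbackWith θ).obj (((F.inverse hlt).covPullbackWith
      (F.inverseConjugators hlt θ)).obj S')).SE (X.graph.edgeOf b')).obj.V) :
    (((F.covPullbackWith θ).obj (((F.inverse hlt).covPullbackWith
        (F.inverseConjugators hlt θ)).obj S')).glue b' v' h').hom.hom.hom x =
      (S'.glue ((inv (C := SemiGraph.{u}) F.base).branchMap (F.base.branchMap b'))
          ((inv (C := SemiGraph.{u}) F.base).vertexMap (F.base.vertexMap v'))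
          ((inv (C := SemiGraph.{u}) F.base).abuts_branchMap _ _ (F.base.abuts_branchMap b' v' h'))).hom.hom.hom
        (S'.castPtE ((congrArg (inv (C := SemiGraph.{u}) F.base).edgeMap (F.base.edgeOf_branchMap b').symm).trans
          ((inv (C := SemiGraph.{u}) F.base).edgeOf_branchMap _).symm) x) := by
  rw [covPullbackWith_glue_apply_castPtE, CovObj.castPtE_covPullbackWith]
  change (S'.SV _).obj.ρ (F.inverseHV hlt _ (θ.θ b' v' h'))
      (((((F.inverse hlt).covPullbackWith (F.inverseConjugators hlt θ)).obj S').glue _ _ _).hom.hom.hom _) = _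
  rw [covPullbackWith_glue_apply_castPtE, inverseConjugators_θ, ← ρ_mul_apply,
    inverseHV_θ_mul_inverseθ, ρ_one_apply, CovObj.castPtE_castPtE]

/-- The components of the counit are compatible with the gluings. [cite: MochizukiSemiAnbd2006, Prop 3.6(iv) p.39] -/
theorem counitIso_comm (S' : CovObj X) (b' : X.graph.Branch) (v' : X.graph.Vertex)
    (h' : X.graph.abuts b' = some v') :
    (F.counitIsoE hlt θ S' (X.graph.edgeOf b')).hom ≫ (S'.glue b' v' h').hom =
      (((F.covPullbackWith θ).obj (((F.inverse hlt).covPullbackWith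
          (F.inverseConjugators hlt θ)).obj S')).glue b' v' h').hom ≫
        (BTemp.res (X.brHom b' v' h')).map (F.counitIsoV hlt θ S' v').hom := by
  refine hom_ext_apply fun x => ?_
  change (S'.glue b' v' h').hom.hom.hom ((F.counitIsoE hlt θ S' _).hom.hom.hom x) =
    (F.counitIsoV hlt θ S' v').hom.hom.hom ((((F.covPullbackWith θ).obj
      (((F.inverse hlt).covPullbackWith (F.inverseConjugators hlt θ)).obj S')).glue b' v' h').hom.hom.hom x)
  rw [counitIsoE_hom_apply, counitIsoV_hom_apply, covPullbackWith_inverse_covPullbackWith_glue_apply,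
    S'.castPtV_glue (SemiGraph.inv_branchMap_branchMap F.base b') (SemiGraph.inv_vertexMap_vertexMap F.base v')
      ((inv (C := SemiGraph.{u}) F.base).abuts_branchMap _ _ (F.base.abuts_branchMap b' v' h')) h',
    CovObj.castPtE_castPtE]

/-- **The counit** `(F⁻¹)^*_{θ⁻¹} ⋙ F^*_θ ≅ 𝟭` on `B^cov(X)`. [cite: MochizukiSemiAnbd2006, Prop 3.6(iv) p.39] -/
def covPullbackCounitIso :
    (F.inverse hlt).covPullbackWith (F.inverseConjugators hlt θ) ⋙ F.covPullbackWith θ ≅ 𝟭 (CovObj X) :=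
  NatIso.ofComponents
    (fun S' => CovObj.isoOfComponents (F.counitIsoV hlt θ S') (F.counitIsoE hlt θ S')
      (F.counitIso_comm hlt θ S'))
    (fun {S' T'} f => by
      refine CovHom.ext (funext fun v' => hom_ext_apply fun x => ?_)
        (funext fun e' => hom_ext_apply fun x => ?_)
      · change (F.counitIsoV hlt θ T' v').hom.hom.hom
            ((f.fV ((inv (C := SemiGraph.{u}) F.base).vertexMap (F.base.vertexMap v'))).hom.hom x) =
          (f.fV v').hom.hom ((F.counitIsoV hlt θ S' v').hom.hom.hom x)
        rw [counitIsoV_hom_apply, counitIsoV_hom_apply, CovObj.castPtV_fV]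
      · change (F.counitIsoE hlt θ T' e').hom.hom.hom
            ((f.fE ((inv (C := SemiGraph.{u}) F.base).edgeMap (F.base.edgeMap e'))).hom.hom x) =
          (f.fE e').hom.hom ((F.counitIsoE hlt θ S' e').hom.hom.hom x)
        rw [counitIsoE_hom_apply, counitIsoE_hom_apply, CovObj.castPtE_fE])

/-! ### The equivalences -/

/-- **Pull-back along an isomorphism of profinite presentations is an equivalence
`B^cov(Y) ≌ B^cov(X)`** (functor `F^*_θ`, inverse `(F⁻¹)^*_{θ⁻¹}`). [cite: MochizukiSemiAnbd2006, Prop 3.6(iv) p.39] -/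
def covPullbackEquiv : CovObj Y ≌ CovObj X :=
  CategoryTheory.Equivalence.mk (F.covPullbackWith θ)
    ((F.inverse hlt).covPullbackWith (F.inverseConjugators hlt θ))
    (F.covPullbackUnitIso hlt θ) (F.covPullbackCounitIso hlt θ)

/-- The functor of `covPullbackEquiv` is `F^*_θ` (definitional). [cite: MochizukiSemiAnbd2006, Prop 3.6(iv) p.39] -/
@[simp] theorem covPullbackEquiv_functor : (F.covPullbackEquiv hlt θ).functor = F.covPullbackWith θ := rfl

/-- The inverse of `covPullbackEquiv` is `(F⁻¹)^*_{θ⁻¹}` (definitional). [cite: MochizukiSemiAnbd2006, Prop 3.6(iv) p.39] -/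
@[simp] theorem covPullbackEquiv_inverse :
    (F.covPullbackEquiv hlt θ).inverse = (F.inverse hlt).covPullbackWith (F.inverseConjugators hlt θ) := rfl

include hlt in
/-- `F^*_θ : B^cov(Y) ⥤ B^cov(X)` is an equivalence of categories. [cite: MochizukiSemiAnbd2006, Prop 3.6(iv) p.39] -/
theorem isEquivalence_covPullbackWith : (F.covPullbackWith θ).IsEquivalence :=
  (F.covPullbackEquiv hlt θ).isEquivalence_functor

include hlt in
/-- **`F^* : B^cov(Y) ⥤ B^cov(X)` (chosen 2-cells) is an equivalence of categories.**
[cite: MochizukiSemiAnbd2006, Prop 3.6(iv) p.39] -/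
theorem isEquivalence_covPullback : F.covPullback.IsEquivalence :=
  F.isEquivalence_covPullbackWith hlt F.chosenConjugators

/-- **Pull-back along an isomorphism of profinite presentations is an equivalence of temperoids
`B^temp(Y) ≌ B^temp(X)`** (functor `F^*_θ` on tempered objects). [cite: MochizukiSemiAnbd2006, Prop 3.6(iv) p.39] -/
def btempPullbackEquiv : BTempCat Y ≌ BTempCat X :=
  CategoryTheory.Equivalence.mk (F.btempPullbackWith θ)
    ((F.inverse hlt).btempPullbackWith (F.inverseConjugators hlt θ))
    (NatIso.ofComponents (fun S => ObjectProperty.isoMk _ ((F.covPullbackUnitIso hlt θ).app S.obj))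
      (fun f => ObjectProperty.hom_ext _ ((F.covPullbackUnitIso hlt θ).hom.naturality f.hom)))
    (NatIso.ofComponents (fun S' => ObjectProperty.isoMk _ ((F.covPullbackCounitIso hlt θ).app S'.obj))
      (fun f => ObjectProperty.hom_ext _ ((F.covPullbackCounitIso hlt θ).hom.naturality f.hom)))

/-- The functor of `btempPullbackEquiv` is `F^*_θ` (definitional). [cite: MochizukiSemiAnbd2006, Prop 3.6(iv) p.39] -/
@[simp] theorem btempPullbackEquiv_functor :
    (F.btempPullbackEquiv hlt θ).functor = F.btempPullbackWith θ := rfl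

/-- The inverse of `btempPullbackEquiv` is `(F⁻¹)^*_{θ⁻¹}` (definitional). [cite: MochizukiSemiAnbd2006, Prop 3.6(iv) p.39] -/
@[simp] theorem btempPullbackEquiv_inverse :
    (F.btempPullbackEquiv hlt θ).inverse = (F.inverse hlt).btempPullbackWith (F.inverseConjugators hlt θ) := rfl

include hlt in
/-- `F^*_θ : B^temp(Y) ⥤ B^temp(X)` is an equivalence of categories. [cite: MochizukiSemiAnbd2006, Prop 3.6(iv) p.39] -/
theorem isEquivalence_btempPullbackWith : (F.btempPullbackWith θ).IsEquivalence :=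
  (F.btempPullbackEquiv hlt θ).isEquivalence_functor

include hlt in
/-- **[SemiAnbd] Prop. 3.6 (iv) for isomorphisms: `F^* : B^temp(Y) ⥤ B^temp(X)` is an equivalence of
temperoids** (so `π₁^temp(X) ≅ π₁^temp(Y)`: sequel `ProfiniteSemiGraphIsoTransportCharts`).
[cite: MochizukiSemiAnbd2006, Prop 3.6(iv) p.39] -/
theorem isEquivalence_btempPullback : F.btempPullback.IsEquivalence :=
  F.isEquivalence_btempPullbackWith hlt F.chosenConjugators

end Hom

end ProfiniteSemiGraph

end Literature.AnabelianGeometry.SemiGraphs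

end
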